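import Mathlib
import Summits.Ventures.PercRepro.TriangleCapSixNine
import Summits.Ventures.PercRepro.TriangleCapRowsUnified

/-!
# PercRepro — THE CELLS `(8, 12) = 36` AND `(9, 13) = 42` OF THE `K₄⁻`-FREE CHERRY TABLE, AND THE ROW `m = k + 4`
EXACT FOR EVERY `k ≥ 8` (p3, gen 32; part 19)

The row `t = 5` (`m = k + 4`) is the star value `C(k − 1, 2) + 10` from the threshold `k = 13` on
(TriangleCapRowGeneral), the bipartite value `C(k − 1, 2) + 10 + j` at `k = 13 − j` for `j ≤ 3`
(TriangleCapBelowThreshold); the two cells below, `(9, 13)` four below and `(8, 12)` five below (`K_{2,6}` itself,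
`k = t + 3`), are the census's `42` and `36`.  Both close by TriangleCapSevenTen's method — the count at a vertex of
maximum degree with the defect sum split into the matching pairs (avoided by `≥ m′ + d − k` edges each) and the
rest: **`cherries_le_thirty_six_of_k4mFree`**, **`cherries_le_forty_two_of_k4mFree`**, hence
**`eight_twelve_exact`**, **`nine_thirteen_exact`** and **`row_plus_four_from_eight`** — the row `m = k + 4` is
exactly `C(k − 1, 2) + 10 + (13 − k)` (natural subtraction) for every `k ≥ 8`: `36, 42, 49, 57, 66`, then the star
value.  The cell `(7, 11) = 25` (`k < t + 3`, no bipartite competitor) stays census.  Axioms: standard.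
-/

namespace PercRepro

namespace TriangleCap

namespace C047

open Finset

variable {V : Type*} [Fintype V] [DecidableEq V]

/-- **THE CELL `(8, 12)`, THE BOUND:** every `K₄⁻`-free graph with `12` edges on `8` vertices has
`Σ_v C(d(v), 2) ≤ 36`. -/
theorem cherries_le_thirty_six_of_k4mFree (D : SimpleGraph V) [DecidableRel D.Adj] (hK : K4mFree D)
    (hk : Fintype.card V = 8) (hm : D.edgeFinset.card = 12) : cherries D ≤ 36 := by
  by_cases hdeg : ∀ v, deg D v ≤ 4
  · -- every degree `≤ 4`: `2·cherries ≤ 3 Σ d = 6m`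
    have h2 : 2 * cherries D ≤ (4 - 1) * ∑ v, deg D v := by
      unfold cherries
      rw [mul_sum, mul_sum]
      exact sum_le_sum (fun v _ => two_mul_choose_two_le_pred_mul _ _ (hdeg v))
    rw [sum_deg_eq, hm] at h2
    omega
  · push Not at hdeg
    obtain ⟨u, hu⟩ := hdeg
    -- a vertex of maximum degree, of degree `≥ 5`
    obtain ⟨v, -, hmax⟩ := exists_max_image univ (deg D) ⟨u, mem_univ u⟩
    have hmax' : ∀ w, deg D w ≤ deg D v := fun w => hmax w (mem_univ w)
    have hv : 5 ≤ deg D v := by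
      have := hmax' u
      omega
    -- the split of `2 Σ d²` (TriangleCapDiagonal) and the counts at `v`
    have hS := sum_adjPairsAll_deg_add D
    have hsplit1 := sum_filter_add_sum_filter_not (adjPairsAll D) (fun p => p.1 = v)
      (fun p => deg D p.1 + deg D p.2)
    have hsplit2 := sum_filter_add_sum_filter_not ((adjPairsAll D).filter (fun p => ¬ p.1 = v))
      (fun p => p.2 = v) (fun p => deg D p.1 + deg D p.2)
    rw [filter_not_fst_filter_snd, filter_not_fst_filter_not_snd] at hsplit2
    have hfst := sum_filter_fst_deg_add D v
    have hsnd := sum_filter_snd_deg_add D v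
    have hA := sum_deg_neighbors_eq D v
    have hE := two_mul_card_E_le D v
    have hT := card_T_le_deg D hK v
    have hRc := two_mul_card_edges_eq D v
    have hR1 := sum_R_add_sum_avoid_le D v
    have hc := two_mul_cherries_add D
    rw [sum_deg_eq] at hc
    have hdk : deg D v + 1 ≤ Fintype.card V := by
      have hsub : univ.filter (fun w => D.Adj v w) ⊆ univ.erase v := by
        intro w hw
        rw [mem_filter] at hw
        rw [mem_erase]
        exact ⟨(D.ne_of_adj hw.2).symm, mem_univ _⟩
      have h1 : deg D v ≤ (univ.erase v).card := card_le_card hsub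
      rw [card_erase_of_mem (mem_univ v), card_univ] at h1
      have h2 : 1 ≤ Fintype.card V := Fintype.card_pos_iff.mpr ⟨v⟩
      omega
    -- the combined linear bound with the defect sum
    have hmain : 2 * (∑ x, deg D x * deg D x) + (offPairs D v).card * deg D v +
        ∑ p ∈ offPairs D v, (avoid D v p).card ≤
        2 * (deg D v * deg D v) + 2 * deg D v +
          4 * ((offPairs D v).filter (fun p => D.Adj v p.1)).card +
          (offPairs D v).card * D.edgeFinset.card + (offPairs D v).card := by
      linarith [hS, hsplit1, hsplit2, hfst, hsnd, hA, hR1]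
    -- the structural facts, instantiated
    have hdom : deg D v + 1 = Fintype.card V →
        ((offPairs D v).filter (fun p => D.Adj v p.1 ∧ D.Adj v p.2)).card = (offPairs D v).card :=
      fun h => congrArg card (filter_T_eq_offPairs_of_deg_add_one_eq_card D h)
    have hEc := card_offEdges D v
    -- a vertex `c` of maximum off-degree
    obtain ⟨c, -, hcmax⟩ := exists_max_image univ (outDeg D v) ⟨v, mem_univ v⟩
    have hcmax' : ∀ w, outDeg D v w ≤ outDeg D v c := fun w => hcmax w (mem_univ w)
    have hδd : outDeg D v c ≤ deg D v := (outDeg_le_deg D v c).trans (hmax' c)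
    have hδ1 := sum_avoid_ge_of_outDeg D v c
    -- the defect sum split into the matching pairs and the rest, with every off-degree `≤ δ`
    have hL := sum_avoid_ge_of_T_of_outDeg_le D hK v (outDeg D v c) hcmax'
    -- names for the quantities
    set T := ((offPairs D v).filter (fun p => D.Adj v p.1 ∧ D.Adj v p.2)).card with hTdef
    set E := ((offPairs D v).filter (fun p => D.Adj v p.1)).card with hEdef
    set Rc := (offPairs D v).card with hRcdef
    set Y := ∑ p ∈ offPairs D v, (avoid D v p).card with hYdef
    set Ec := (offEdges D v).card with hEcdef
    set δ := outDeg D v c with hδdef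
    set d := deg D v with hddef
    set m := D.edgeFinset.card with hmdef
    set k := Fintype.card V with hkdef
    set ch := cherries D with hchdef
    set s2 := ∑ x, deg D x * deg D x with hs2def
    clear_value T E Rc Y Ec δ d m k ch s2
    have hfin : 2 * s2 + Rc * d + Y ≤ 2 * (d * d) + 2 * d + 2 * Rc + 2 * T + Rc * m + Rc := by
      linarith [hmain, hE]
    clear hmain hS hsplit1 hsplit2 hfst hsnd hA hR1 hE hTdef hEdef hRcdef hYdef hEcdef hδdef hddef
      hmdef hkdef hchdef hs2def hmax hmax' hcmax hcmax' hu
    subst hk hm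
    obtain ⟨a, rfl⟩ : ∃ a, d = 5 + a := ⟨d - 5, by omega⟩
    rcases (by omega : a = 0 ∨ a = 1 ∨ a = 2) with rfl | rfl | rfl
    · -- maximum degree `5`: `|R| = 14`, `m′ = 7`; `Y ≥ 2T + 8`
      have hRc' : Rc = 14 := by omega
      have hEc' : Ec = 7 := by omega
      subst hRc' hEc'
      have hY : 2 * T + 8 ≤ Y := by
        by_cases hδ4 : 4 ≤ δ
        · rcases (by omega : δ = 4 ∨ δ = 5) with hδ' | hδ' <;> subst hδ' <;> omega
        · have h1 : (14 - T) * 2 ≤ (14 - T) * (7 + 1 - 2 * δ) := Nat.mul_le_mul_left _ (by omega)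
          omega
      omega
    · -- maximum degree `6`: `|R| = 12`, `m′ = 6`; the matching pairs are avoided by `≥ 4` edges each
      have hRc' : Rc = 12 := by omega
      have hEc' : Ec = 6 := by omega
      subst hRc' hEc'
      have h0 := Nat.zero_le ((12 - T) * (6 + 1 - 2 * δ))
      omega
    · -- maximum degree `7` (dominating): `T = |R| = 10 > 7`, impossible
      have hT2 := hdom (by omega)
      omega

/-- **THE CELL `(9, 13)`, THE BOUND:** every `K₄⁻`-free graph with `13` edges on `9` vertices has
`Σ_v C(d(v), 2) ≤ 42`. -/
theorem cherries_le_forty_two_of_k4mFree (D : SimpleGraph V) [DecidableRel D.Adj] (hK : K4mFree D)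
    (hk : Fintype.card V = 9) (hm : D.edgeFinset.card = 13) : cherries D ≤ 42 := by
  by_cases hdeg : ∀ v, deg D v ≤ 4
  · -- every degree `≤ 4`: `2·cherries ≤ 3 Σ d = 6m`
    have h2 : 2 * cherries D ≤ (4 - 1) * ∑ v, deg D v := by
      unfold cherries
      rw [mul_sum, mul_sum]
      exact sum_le_sum (fun v _ => two_mul_choose_two_le_pred_mul _ _ (hdeg v))
    rw [sum_deg_eq, hm] at h2
    omega
  · push Not at hdeg
    obtain ⟨u, hu⟩ := hdeg
    -- a vertex of maximum degree, of degree `≥ 5`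
    obtain ⟨v, -, hmax⟩ := exists_max_image univ (deg D) ⟨u, mem_univ u⟩
    have hmax' : ∀ w, deg D w ≤ deg D v := fun w => hmax w (mem_univ w)
    have hv : 5 ≤ deg D v := by
      have := hmax' u
      omega
    -- the split of `2 Σ d²` (TriangleCapDiagonal) and the counts at `v`
    have hS := sum_adjPairsAll_deg_add D
    have hsplit1 := sum_filter_add_sum_filter_not (adjPairsAll D) (fun p => p.1 = v)
      (fun p => deg D p.1 + deg D p.2)
    have hsplit2 := sum_filter_add_sum_filter_not ((adjPairsAll D).filter (fun p => ¬ p.1 = v))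
      (fun p => p.2 = v) (fun p => deg D p.1 + deg D p.2)
    rw [filter_not_fst_filter_snd, filter_not_fst_filter_not_snd] at hsplit2
    have hfst := sum_filter_fst_deg_add D v
    have hsnd := sum_filter_snd_deg_add D v
    have hA := sum_deg_neighbors_eq D v
    have hE := two_mul_card_E_le D v
    have hT := card_T_le_deg D hK v
    have hRc := two_mul_card_edges_eq D v
    have hR1 := sum_R_add_sum_avoid_le D v
    have hc := two_mul_cherries_add D
    rw [sum_deg_eq] at hc
    have hdk : deg D v + 1 ≤ Fintype.card V := by
      have hsub : univ.filter (fun w => D.Adj v w) ⊆ univ.erase v := by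
        intro w hw
        rw [mem_filter] at hw
        rw [mem_erase]
        exact ⟨(D.ne_of_adj hw.2).symm, mem_univ _⟩
      have h1 : deg D v ≤ (univ.erase v).card := card_le_card hsub
      rw [card_erase_of_mem (mem_univ v), card_univ] at h1
      have h2 : 1 ≤ Fintype.card V := Fintype.card_pos_iff.mpr ⟨v⟩
      omega
    -- the combined linear bound with the defect sum
    have hmain : 2 * (∑ x, deg D x * deg D x) + (offPairs D v).card * deg D v +
        ∑ p ∈ offPairs D v, (avoid D v p).card ≤
        2 * (deg D v * deg D v) + 2 * deg D v +
          4 * ((offPairs D v).filter (fun p => D.Adj v p.1)).card +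
          (offPairs D v).card * D.edgeFinset.card + (offPairs D v).card := by
      linarith [hS, hsplit1, hsplit2, hfst, hsnd, hA, hR1]
    -- the structural facts, instantiated
    have hdom : deg D v + 1 = Fintype.card V →
        ((offPairs D v).filter (fun p => D.Adj v p.1 ∧ D.Adj v p.2)).card = (offPairs D v).card :=
      fun h => congrArg card (filter_T_eq_offPairs_of_deg_add_one_eq_card D h)
    have hEc := card_offEdges D v
    -- a vertex `c` of maximum off-degree
    obtain ⟨c, -, hcmax⟩ := exists_max_image univ (outDeg D v) ⟨v, mem_univ v⟩
    have hcmax' : ∀ w, outDeg D v w ≤ outDeg D v c := fun w => hcmax w (mem_univ w)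
    have hδd : outDeg D v c ≤ deg D v := (outDeg_le_deg D v c).trans (hmax' c)
    have hδ1 := sum_avoid_ge_of_outDeg D v c
    -- the defect sum split into the matching pairs and the rest, with every off-degree `≤ δ`
    have hL := sum_avoid_ge_of_T_of_outDeg_le D hK v (outDeg D v c) hcmax'
    -- names for the quantities
    set T := ((offPairs D v).filter (fun p => D.Adj v p.1 ∧ D.Adj v p.2)).card with hTdef
    set E := ((offPairs D v).filter (fun p => D.Adj v p.1)).card with hEdef
    set Rc := (offPairs D v).card with hRcdef
    set Y := ∑ p ∈ offPairs D v, (avoid D v p).card with hYdef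
    set Ec := (offEdges D v).card with hEcdef
    set δ := outDeg D v c with hδdef
    set d := deg D v with hddef
    set m := D.edgeFinset.card with hmdef
    set k := Fintype.card V with hkdef
    set ch := cherries D with hchdef
    set s2 := ∑ x, deg D x * deg D x with hs2def
    clear_value T E Rc Y Ec δ d m k ch s2
    have hfin : 2 * s2 + Rc * d + Y ≤ 2 * (d * d) + 2 * d + 2 * Rc + 2 * T + Rc * m + Rc := by
      linarith [hmain, hE]
    clear hmain hS hsplit1 hsplit2 hfst hsnd hA hR1 hE hTdef hEdef hRcdef hYdef hEcdef hδdef hddef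
      hmdef hkdef hchdef hs2def hmax hmax' hcmax hcmax' hu
    subst hk hm
    obtain ⟨a, rfl⟩ : ∃ a, d = 5 + a := ⟨d - 5, by omega⟩
    rcases (by omega : a = 0 ∨ a = 1 ∨ a = 2 ∨ a = 3) with rfl | rfl | rfl | rfl
    · -- maximum degree `5`: `|R| = 16`, `m′ = 8`; `Y ≥ 2T + 16`
      have hRc' : Rc = 16 := by omega
      have hEc' : Ec = 8 := by omega
      subst hRc' hEc'
      have hY : 2 * T + 16 ≤ Y := by
        by_cases hδ4 : 4 ≤ δ
        · rcases (by omega : δ = 4 ∨ δ = 5) with hδ' | hδ' <;> subst hδ' <;> omega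
        · have h1 : (16 - T) * 3 ≤ (16 - T) * (8 + 1 - 2 * δ) := Nat.mul_le_mul_left _ (by omega)
          omega
      omega
    · -- maximum degree `6`: `|R| = 14`, `m′ = 7`; `Y ≥ 2T + 4`
      have hRc' : Rc = 14 := by omega
      have hEc' : Ec = 7 := by omega
      subst hRc' hEc'
      have hY : 2 * T + 4 ≤ Y := by
        by_cases hδ4 : 4 ≤ δ
        · rcases (by omega : δ = 4 ∨ δ = 5 ∨ δ = 6) with hδ' | hδ' | hδ' <;> subst hδ' <;> omega
        · have h1 : (14 - T) * 2 ≤ (14 - T) * (7 + 1 - 2 * δ) := Nat.mul_le_mul_left _ (by omega)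
          omega
      omega
    · -- maximum degree `7`: `|R| = 12`, `m′ = 6`; the matching pairs are avoided by `≥ 4` edges each
      have hRc' : Rc = 12 := by omega
      have hEc' : Ec = 6 := by omega
      subst hRc' hEc'
      have h0 := Nat.zero_le ((12 - T) * (6 + 1 - 2 * δ))
      omega
    · -- maximum degree `8` (dominating): `T = |R| = 10 > 8`, impossible
      have hT2 := hdom (by omega)
      omega

/-- **THE CELL `(8, 12) = 36`, EXACT:** `K_{2,6}` (`bipPend 8 5`) attains the bound. -/
theorem eight_twelve_exact :
    (∀ (D : SimpleGraph (Fin 8)) [DecidableRel D.Adj], K4mFree D → D.edgeFinset.card = 12 →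
        cherries D ≤ 36) ∧
      ∃ (D : SimpleGraph (Fin 8)) (_ : DecidableRel D.Adj),
        K4mFree D ∧ D.edgeFinset.card = 12 ∧ cherries D = 36 := by
  refine ⟨fun D _ hK hD => cherries_le_thirty_six_of_k4mFree D hK (by simp) hD,
    bipPend 8 5, inferInstance, k4mFree_bipPend 8 5, ?_, ?_⟩
  · have := card_edges_bipPend 8 5 (by norm_num)
    omega
  · rw [cherries_bipPend 8 5 (by norm_num)]
    decide

/-- **THE CELL `(9, 13) = 42`, EXACT:** `K_{2,6}` plus a pendant edge (`bipPend 9 5`) attains the bound. -/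
theorem nine_thirteen_exact :
    (∀ (D : SimpleGraph (Fin 9)) [DecidableRel D.Adj], K4mFree D → D.edgeFinset.card = 13 →
        cherries D ≤ 42) ∧
      ∃ (D : SimpleGraph (Fin 9)) (_ : DecidableRel D.Adj),
        K4mFree D ∧ D.edgeFinset.card = 13 ∧ cherries D = 42 := by
  refine ⟨fun D _ hK hD => cherries_le_forty_two_of_k4mFree D hK (by simp) hD,
    bipPend 9 5, inferInstance, k4mFree_bipPend 9 5, ?_, ?_⟩
  · have := card_edges_bipPend 9 5 (by norm_num)
    omega
  · rw [cherries_bipPend 9 5 (by norm_num)]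
    decide

/-- **THE ROW `m = k + 4`, EXACT FOR EVERY `k ≥ 8`:** the maximum is `C(k − 1, 2) + 10 + (13 − k)` — `36, 42, 49, 57,
66` at `k = 8 … 12` (`K_{2,6}` plus `k − 8` pendant edges) and the star value `C(k − 1, 2) + 10` from `k = 13` on. -/
theorem row_plus_four_from_eight (k : ℕ) (hk : 8 ≤ k) :
    (∀ (D : SimpleGraph (Fin k)) [DecidableRel D.Adj], K4mFree D → D.edgeFinset.card = k + 4 →
        cherries D ≤ (k - 1).choose 2 + 10 + (13 - k)) ∧
      ∃ (D : SimpleGraph (Fin k)) (_ : DecidableRel D.Adj), K4mFree D ∧ D.edgeFinset.card = k + 4 ∧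
        cherries D = (k - 1).choose 2 + 10 + (13 - k) := by
  rcases (by omega : k = 8 ∨ k = 9 ∨ (10 ≤ k ∧ k ≤ 12) ∨ 13 ≤ k) with rfl | rfl | ⟨h10, h12⟩ | h13
  · obtain ⟨h1, D, inst, hK, hD, hc⟩ := eight_twelve_exact
    have e : (8 - 1).choose 2 = 21 := by decide
    exact ⟨fun D _ hK hD => by have := h1 D hK hD; omega, D, inst, hK, hD, by omega⟩
  · obtain ⟨h1, D, inst, hK, hD, hc⟩ := nine_thirteen_exact
    have e : (9 - 1).choose 2 = 28 := by decide
    exact ⟨fun D _ hK hD => by have := h1 D hK hD; omega, D, inst, hK, hD, by omega⟩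
  · obtain ⟨h1, h2⟩ := rows_below_exact 5 k (13 - k) (by norm_num) (by omega) (by omega)
    exact ⟨fun D _ hK hD => by have := h1 D hK (by omega); omega, by
      obtain ⟨D, inst, hK, hD, hc⟩ := h2
      exact ⟨D, inst, hK, by omega, by omega⟩⟩
  · obtain ⟨h1, h2⟩ := rows_exact 5 k (by norm_num) (by omega) (by omega)
    have e : 13 - k = 0 := by omega
    rw [e]
    exact ⟨fun D _ hK hD => by have := h1 D hK (by omega); omega, by
      obtain ⟨D, inst, hK, hD, hc⟩ := h2
      exact ⟨D, inst, hK, by omega, by omega⟩⟩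

end C047

end TriangleCap

end PercRepro
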